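import Mathlib

/-!
# Roll–streak intertwining identities at finite absorption (kernel #231, lemmaR-A3 §8(q), PLAN §113)

Solo-blind programme, session s90.  Kernel #230 (`SoloBlindBulkBloch`) proved the ROLL BLOCH IDENTITY
`(z - J_rr)[m μ^m] = (2h(1-μ²)/μ)[μ^m]` for the FREE chains.  The same computation works verbatim for
the ABSORBING chains of the frozen `κ = 0⁺` column operator, because streaks `s_m` and rolls `r_m`
carry the SAME absorption `D_m = ε K₀ m²` (up to the constant shift `2εa₀`): for ANY sequence `ψ`
define the streak residual `E_m := z ψ_m - h(ψ_{m+1} + ψ_{m-1}) + D_m ψ_m`; then, row by row (`m ≥ 2`),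

* (I1) `(z - J_rr + D)[m ψ_m] = m E_m + 2h (ψ_{m-1} - ψ_{m+1})`,
* (I2) `(z - J_rr + D)[ψ_m]   = E_m + h (ψ_{m-1}/(m-1) - ψ_{m+1}/(m+1))`,

where `(J_rr f)_m = h((m-2)/(m-1) f_{m-1} + (m+2)/(m+1) f_{m+1})`.  So for a streak SOLUTION (`E = 0`)
the roll resolvent maps the central difference `2h(ψ_{m-1} - ψ_{m+1})` to `m ψ_m` exactly, and `ψ`
itself to the `α`-hop shape `h(ψ_{m-1}/(m-1) - ψ_{m+1}/(m+1))` — the finite-`ε` skeleton of the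
near-bulk expansion of `Φ(z) = e_{r2}ᵀ 𝔊_r(z) P 𝔊_s(z) q` (regime (II) of LEMMA R⁺).
For the Bloch wave `ψ_m = μ^m`, `E = 0` iff `zμ = h(μ²+1) - D_m μ`; with `D = 0` (I1) is #230 §C.
-/

namespace Summit.AnomalousDissipation.AnomalousDissipation.Theorems

/-- (I1) The roll row applied to `m ψ_m` equals `m ·` (streak residual) `+ 2h(ψ_{m-1} - ψ_{m+1})`,
for every row `m = n + 1 ≥ 2` (the divisions `(m-2)/(m-1)·(m-1)` and `(m+2)/(m+1)·(m+1)` cancel). -/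
theorem rollIntertwining_I1 (h z : ℂ) (D ψ : ℕ → ℂ) (n : ℕ) (hn : 1 ≤ n) :
    z * (((n : ℂ) + 1) * ψ (n + 1))
      - h * ((((n : ℂ) + 1) - 2) / (((n : ℂ) + 1) - 1) * ((n : ℂ) * ψ n)
             + (((n : ℂ) + 1) + 2) / (((n : ℂ) + 1) + 1) * (((n : ℂ) + 2) * ψ (n + 2)))
      + D (n + 1) * (((n : ℂ) + 1) * ψ (n + 1))
      = ((n : ℂ) + 1) * (z * ψ (n + 1) - h * (ψ (n + 2) + ψ n) + D (n + 1) * ψ (n + 1))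
        + 2 * h * (ψ n - ψ (n + 2)) := by
  have hn0 : (n : ℂ) ≠ 0 := by exact_mod_cast (show n ≠ 0 by omega)
  have hn2 : (n : ℂ) + 2 ≠ 0 := by
    have : ((n + 2 : ℕ) : ℂ) ≠ 0 := by exact_mod_cast (show n + 2 ≠ 0 by omega)
    push_cast at this; exact this
  have e1 : (((n : ℂ) + 1) - 2) / (((n : ℂ) + 1) - 1) * ((n : ℂ) * ψ n)
      = (((n : ℂ) + 1) - 2) * ψ n := by
    rw [show ((n : ℂ) + 1) - 1 = n by ring, ← mul_assoc, div_mul_cancel₀ _ hn0]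
  have e2 : (((n : ℂ) + 1) + 2) / (((n : ℂ) + 1) + 1) * (((n : ℂ) + 2) * ψ (n + 2))
      = (((n : ℂ) + 1) + 2) * ψ (n + 2) := by
    rw [show ((n : ℂ) + 1) + 1 = n + 2 by ring, ← mul_assoc, div_mul_cancel₀ _ hn2]
  rw [e1, e2]; ring

/-- (I2) The roll row applied to `ψ_m` itself equals the streak residual plus the `α`-hop shape
`h(ψ_{m-1}/(m-1) - ψ_{m+1}/(m+1))`. -/
theorem rollIntertwining_I2 (h z : ℂ) (D ψ : ℕ → ℂ) (n : ℕ) (hn : 1 ≤ n) :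
    z * ψ (n + 1)
      - h * ((((n : ℂ) + 1) - 2) / (((n : ℂ) + 1) - 1) * ψ n
             + (((n : ℂ) + 1) + 2) / (((n : ℂ) + 1) + 1) * ψ (n + 2))
      + D (n + 1) * ψ (n + 1)
      = (z * ψ (n + 1) - h * (ψ (n + 2) + ψ n) + D (n + 1) * ψ (n + 1))
        + h * (ψ n / (((n : ℂ) + 1) - 1) - ψ (n + 2) / (((n : ℂ) + 1) + 1)) := by
  have hn0 : ((n : ℂ) + 1) - 1 ≠ 0 := by
    rw [show ((n : ℂ) + 1) - 1 = n by ring]; exact_mod_cast (show n ≠ 0 by omega)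
  have hn2 : ((n : ℂ) + 1) + 1 ≠ 0 := by
    rw [show ((n : ℂ) + 1) + 1 = n + 2 by ring]
    have : ((n + 2 : ℕ) : ℂ) ≠ 0 := by exact_mod_cast (show n + 2 ≠ 0 by omega)
    push_cast at this; exact this
  field_simp
  ring

/-- Bloch specialisation: for `ψ_m = μ^m` the streak residual is `μ^n (zμ - h(μ²+1) + D_{n+1} μ)`,
so it vanishes along the LOCAL Bloch relation `zμ + D_m μ = h(μ² + 1)`; with `D = 0` (I1) reduces to
the roll Bloch identity of kernel #230 (`2h(μ^n - μ^{n+2}) = 2h(1-μ²)μ^n`). -/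
theorem rollIntertwining_bloch_residual (h z μ : ℂ) (D : ℕ → ℂ) (n : ℕ) :
    z * μ ^ (n + 1) - h * (μ ^ (n + 2) + μ ^ n) + D (n + 1) * μ ^ (n + 1)
      = μ ^ n * (z * μ - h * (μ ^ 2 + 1) + D (n + 1) * μ)
    ∧ 2 * h * (μ ^ n - μ ^ (n + 2)) = 2 * h * (1 - μ ^ 2) * μ ^ n := by
  constructor <;> ring

/-- The constant-shift remark: if streaks carry `D_m = ε(K₀ m² - a₀)` and rolls `D'_m = ε(K₀ m² + a₀)`
then `D' = D + 2εa₀`, i.e. the identities hold with `z` replaced by `z + 2εa₀` on the roll side. -/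
theorem rollIntertwining_a0_shift (ε K₀ a₀ : ℂ) (m : ℂ) :
    ε * (K₀ * m ^ 2 + a₀) = ε * (K₀ * m ^ 2 - a₀) + 2 * ε * a₀ := by ring

/-- FLUX IDENTITY ingredient (far-zone decay of the subordinate streak solution): for one bond,
`Re(h ψ_m conj(ψ_{m+1}))` with `h = -i/2` is bounded by `|ψ_m| |ψ_{m+1}| / 2`; summing the real part
of `conj(ψ_k)·E_k = 0` over `k > m` leaves only this boundary term because `Re h = 0`. -/
theorem rollIntertwining_flux_bound (ψ₀ ψ₁ : ℂ) :
    (-(Complex.I) / 2 * ψ₀ * (starRingEnd ℂ) ψ₁).re ≤ ‖ψ₀‖ * ‖ψ₁‖ / 2 := by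
  have h1 : (-(Complex.I) / 2 * ψ₀ * (starRingEnd ℂ) ψ₁).re
      ≤ ‖-(Complex.I) / 2 * ψ₀ * (starRingEnd ℂ) ψ₁‖ := Complex.re_le_norm _
  have h2 : ‖-(Complex.I) / 2 * ψ₀ * (starRingEnd ℂ) ψ₁‖ = ‖ψ₀‖ * ‖ψ₁‖ / 2 := by
    rw [norm_mul, norm_mul, norm_div, norm_neg, Complex.norm_I, Complex.norm_conj]
    norm_num; ring
  linarith [h1, h2.le, h2.ge]

end Summit.AnomalousDissipation.AnomalousDissipation.Theorems
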